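import Summits.AtomisticToContinuum.HydrodynamicLimit.Theorems.RelayRaceLocalityNearConstantShortTimeHLMeansPinDefs
import Summits.AtomisticToContinuum.HydrodynamicLimit.Theorems.RelayRaceLocalityNearConstantShortTimeHLGeneralFamilyConcentrationOnePoint
import Summits.AtomisticToContinuum.HydrodynamicLimit.Theorems.RelayRaceLocalityNearConstantShortTimeHLGeneralFamilyConcentrationLocalGibbs
import Summits.AtomisticToContinuum.HydrodynamicLimit.Theorems.AntiMazurCoboundariesKineticWindowGronwallActivityInversion
import HarnessLib

/-!
# Crux `NearConstantShortTimeHL` (stmt-AtomisticToContinuum-12502), line `means-pin-entropy` — stub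
`stub_concentrationGeneralFamilies : GeneralFamilyConcentration`

S2 of the line: EXPONENTIAL CONCENTRATION of the empirical density / momentum / energy fields under the MATCHED
canonical local Gibbs laws of the dilute hard-sphere gas — activity `a₁ = ρ₁ e^{g_σ(ρ₁)}`,
`g_σ(r) = f_ex(rσ³) + rσ³ f_ex′(rσ³)` — for GENERAL diameter/number families `ε_N > 0`, `ε_N → 0`, `n_N ε_N³ → σ³`,
with rate `C e^{-n_N/C}` for ALL `N`, around `∫χρ₁`, `∫(χρ₁)•u₁`, `∫χE(ρ₁,u₁,θ₁)`.

Assembly (the general-family twin of the PROVED conjunct-family item 14445 `uniformLocalGibbsConcentration_proof` and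
of `KineticWindowGronwallActivityInversion.thermoActivity_concentration`):
* IDENTIFICATION — `thermoActivity_spec` (landed): at packing `ρ₁σ³ ≤ thresh r η₂` the thermodynamic activity
  `a₁ = thermoActivity σ ρ₁` is continuous and positive, its profile is in the statics regime with the uniform
  smallness `e · 2M · v₁ σ³ ≤ 1/32`, `σ < 1/2`, and its cluster-series density `rhoLim (profileOf a₁) σ` IS `ρ₁`
  (`insertionFactor_package`: `exp(f_ex(η) + η f_ex′(η))` is the analytic insertion factor, route ImplosionDichotomy);
* GENERAL FAMILIES — parts I–IV of this stub (`…GeneralFamilyConcentrationRatio/Contraction/OnePoint/LocalGibbs`):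
  the low-density expansion re-run along `(ε_N, n_N)` (same limit ratio `R(σ)`, same one-point limit `Ilim`), the
  exponential Chebyshev bound with tilted profiles, the flow-free local Gibbs measure at a general scale and the
  Gaussian velocity Chernoff bound; here the position marginal (`gf_localGibbs_preimage_pos`), the density-type
  events (`gf_localGibbs_density_le`, registered helper `gf_helper_densityField`), the momentum/energy bookkeeping
  (`gf_localGibbs_momentum_le`, `gf_localGibbs_energy_le`), the invisibility of the Liouville restriction
  (`gf_withDensity_liouville_eq`) and the final packaging: early indices with `n_N = 0` are absorbed in the constant
  (the laws are sub-probabilities, `gf_localGibbs_le_one`), and the family is run with `max n_N 1` then transferred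
  (`gf_transfer`).
Sources: E. Pulvirenti – D. Tsagkarogiannis, Comm. Math. Phys. 316 (2012) Thm 2.1; H. Spohn (1991) Part I §2.3;
C. Kipnis – C. Landim (1999) App. 2.
-/

noncomputable section

namespace Summit.AtomisticToContinuum.HydrodynamicLimit.Theorems.NearConstantShortTimeHL

open MeasureTheory ProbabilityTheory Finset Filter Topology
open scoped ENNReal
open Literature.MathematicalPhysics.KineticTheory Literature.MathematicalPhysics.StatisticalMechanics
open Literature.Analysis.FluidPDE Literature.Analysis.FunctionSpaces
open Summit.AtomisticToContinuum.HydrodynamicLimit.Theorems.UniformLGC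
open Summit.AtomisticToContinuum.HydrodynamicLimit.Theorems.KineticWindowGronwallActivityInversion

/-- The flow-free local Gibbs measure of `m` hard spheres of diameter `e` with profiles `(a, u, θ)` (notation only). -/
local notation "μ[" e ", " m ", " a ", " u ", " θ "]" =>
  (volume.withDensity fun z => ENNReal.ofReal
    (canonicalDensity (Torus.geometry (Fin 3)) e m (localGibbsProfile a u θ) z) : Measure (Config m (Fin 3) T3))

/-! ### The position marginal and the density-type events along a general family -/

section Density

variable {a θ : T3 → ℝ} {u : T3 → V3} {σ : ℝ} {ε : ℕ → ℝ} {n : ℕ → ℕ}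

/-- **The position marginal of the flow-free local Gibbs measure at scale `(ε, m)` is the configurational Gibbs
measure `posGibbsMeasure a ε m`.** [folklore] -/
theorem gf_localGibbs_preimage_pos (ha : Continuous a) (hθ : Continuous θ) (hu : Continuous u) (ha0 : ∀ x, 0 ≤ a x)
    (hθ0 : ∀ x, 0 < θ x) (e : ℝ) (m : ℕ) {S : Set (Fin m → T3)} (hS : MeasurableSet S) :
    (volume.withDensity fun z =>
        ENNReal.ofReal (canonicalDensity (Torus.geometry (Fin 3)) e m (localGibbsProfile a u θ) z))
        ((fun z i => (z i).1) ⁻¹' S) = posGibbsMeasure a e m S := by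
  have hposm : Measurable (fun z : Config m (Fin 3) T3 => fun i => (z i).1) :=
    measurable_pi_lambda _ fun i => (measurable_pi_apply i).fst
  rw [← lintegral_indicator_one (hposm hS),
    gf_lintegral_localGibbs ha hθ hu ha0 hθ0 e m (measurable_one.indicator (hposm hS)),
    posGibbsMeasure, withDensity_apply _ hS, ← lintegral_indicator hS]
  refine lintegral_congr fun x => ?_
  have hind : ∀ v : Fin m → V3,
      ((fun z : Config m (Fin 3) T3 => fun i => (z i).1) ⁻¹' S).indicator
        (1 : Config m (Fin 3) T3 → ℝ≥0∞) (zipConfig (x, v)) = S.indicator 1 x := by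
    intro v
    by_cases hx : x ∈ S
    · rw [Set.indicator_of_mem hx, Set.indicator_of_mem (show zipConfig (x, v) ∈ _ from hx)]
      rfl
    · rw [Set.indicator_of_notMem hx, Set.indicator_of_notMem (show zipConfig (x, v) ∉ _ from hx)]
  simp_rw [hind, lintegral_const, measure_univ, mul_one]
  by_cases hx : x ∈ S
  · simp [hx]
  · simp [hx]

/-- **Density-type events with rates along a general family.** For continuous profiles `a, θ > 0`, `u`,
`0 < σ < 1/2` with the uniform smallness `e · 2M · v₁ · σ³ ≤ 1/32` for `P = profileOf a`, a family `ε_N > 0`,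
`ε_N → 0`, `1 ≤ n_N`, `n_N ε_N³ → σ³`, a continuous weight `g` and `δ > 0`:
`μ_N {δ < |n_N⁻¹ ∑ g(xᵢ) - ∫ g ρ₀|} ≤ K e^{-n_N/K}` for all `N`, `ρ₀ = rhoLim P σ`. [folklore] -/
theorem gf_localGibbs_density_le (ha : Continuous a) (hθ : Continuous θ) (hu : Continuous u)
    (ha0 : ∀ x, 0 < a x) (hθ0 : ∀ x, 0 < θ x) (hσ : 0 < σ) (hσ2 : σ < 1 / 2)
    (hsmall : Real.exp 1 * (2 * (profileOf a ha ha0).M * v₁ * σ ^ 3) ≤ 1 / 32)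
    (hε0 : ∀ N, 0 < ε N) (hε : Tendsto ε atTop (𝓝 0)) (hn1 : ∀ N, 1 ≤ n N)
    (hn : Tendsto (fun N => (n N : ℝ) * ε N ^ 3) atTop (𝓝 (σ ^ 3)))
    {g : T3 → ℝ} (hg : Continuous g) {δ : ℝ} (hδ : 0 < δ) :
    ∃ K : ℝ, 0 < K ∧ ∀ N : ℕ, (volume.withDensity fun z =>
        ENNReal.ofReal (canonicalDensity (Torus.geometry (Fin 3)) (ε N) (n N) (localGibbsProfile a u θ) z))
        {z | δ < |((n N : ℕ) : ℝ)⁻¹ * ∑ i, g (z i).1 - ∫ y, g y * rhoLim (profileOf a ha ha0) σ y|} ≤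
      ENNReal.ofReal (K * Real.exp (-(K⁻¹ * (n N : ℝ)))) := by
  set P := profileOf a ha ha0 with hP
  have hPs : SmallDensity P σ :=
    smallDensity_of_eta_le (Mstar := 2 * P.M) hσ hσ2 (by linarith [P.M_pos]) hsmall
  obtain ⟨K, hK, hbound⟩ := gf_density_concentration hσ hσ2 hsmall hε0 hε hn1 hn hg hδ
  refine ⟨K, hK, fun N => ?_⟩
  rw [← hPs.Ilim_eq_integral hg]
  have hS : MeasurableSet {x : Fin (n N) → T3 |
      δ < |((n N : ℕ) : ℝ)⁻¹ * ∑ i, g (x i) - Ilim P σ g|} :=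
    measurableSet_lt measurable_const ((measurable_const.mul (Finset.measurable_sum _
      fun i _ => hg.measurable.comp (measurable_pi_apply i))).sub measurable_const).abs
  have h1 := gf_localGibbs_preimage_pos (u := u) ha hθ hu (fun x => (ha0 x).le) hθ0 (ε N) (n N) hS
  rw [posGibbsMeasure_eq ha ha0] at h1
  exact (le_of_eq h1).trans (hbound N)

end Density

/-- **Registered helper `gf_helper_densityField`** (sub-goal of `stub_concentrationGeneralFamilies`): weighted
density-field events under the flow-free local Gibbs measure along a general family, `gf_localGibbs_density_le` in
closed form. [folklore] -/
theorem gf_helper_densityField :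
    ∀ {a θ : Literature.MathematicalPhysics.KineticTheory.T3 → ℝ}
      {u : Literature.MathematicalPhysics.KineticTheory.T3 → Literature.MathematicalPhysics.KineticTheory.V3}
      {σ : ℝ} {ε : ℕ → ℝ} {n : ℕ → ℕ} (ha : Continuous a), Continuous θ → Continuous u →
      ∀ (ha0 : ∀ x, 0 < a x), (∀ x, 0 < θ x) → 0 < σ → σ < 1 / 2 →
      Real.exp 1 * (2 * (Literature.MathematicalPhysics.KineticTheory.profileOf a ha ha0).M *
        Literature.MathematicalPhysics.KineticTheory.v₁ * σ ^ 3) ≤ 1 / 32 →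
      (∀ N, 0 < ε N) → Filter.Tendsto ε Filter.atTop (nhds 0) → (∀ N, 1 ≤ n N) →
      Filter.Tendsto (fun N => (n N : ℝ) * ε N ^ 3) Filter.atTop (nhds (σ ^ 3)) →
      ∀ {g : Literature.MathematicalPhysics.KineticTheory.T3 → ℝ}, Continuous g → ∀ {δ : ℝ}, 0 < δ →
      ∃ K : ℝ, 0 < K ∧ ∀ N : ℕ, (MeasureTheory.volume.withDensity fun z => ENNReal.ofReal
          (Literature.Analysis.FluidPDE.canonicalDensity (Literature.Analysis.FluidPDE.Torus.geometry (Fin 3)) (ε N) (n N)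
            (Literature.MathematicalPhysics.KineticTheory.localGibbsProfile a u θ) z))
          {z | δ < |((n N : ℕ) : ℝ)⁻¹ * ∑ i, g (z i).1 -
            ∫ y, g y * Literature.MathematicalPhysics.KineticTheory.rhoLim
              (Literature.MathematicalPhysics.KineticTheory.profileOf a ha ha0) σ y|} ≤
        ENNReal.ofReal (K * Real.exp (-(K⁻¹ * (n N : ℝ)))) :=
  fun ha hθ hu ha0 hθ0 hσ hσ2 hsmall hε0 hε hn1 hn _ hg _ hδ =>
    gf_localGibbs_density_le ha hθ hu ha0 hθ0 hσ hσ2 hsmall hε0 hε hn1 hn hg hδ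


/-! ### The momentum and energy fields along a general family -/

section Fields

variable {a θ : T3 → ℝ} {u : T3 → V3} {σ : ℝ} {ε : ℕ → ℝ} {n : ℕ → ℕ}

/-- **Momentum field along a general family.** Under the uniform smallness, for continuous `χ` and `δ > 0`:
`μ_N {δ < ‖n_N⁻¹ ∑ χ(xᵢ) vᵢ - ∫ χ ρ₀ u‖} ≤ K e^{-n_N/K}` for all `N` (coordinatewise: Maxwellian fluctuation + density
field with weight `χ uₗ`). [folklore] -/
theorem gf_localGibbs_momentum_le (ha : Continuous a) (hθ : Continuous θ) (hu : Continuous u)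
    (ha0 : ∀ x, 0 < a x) (hθ0 : ∀ x, 0 < θ x) (hσ : 0 < σ) (hσ2 : σ < 1 / 2)
    (hsmall : Real.exp 1 * (2 * (profileOf a ha ha0).M * v₁ * σ ^ 3) ≤ 1 / 32)
    (hε0 : ∀ N, 0 < ε N) (hε : Tendsto ε atTop (𝓝 0)) (hn1 : ∀ N, 1 ≤ n N)
    (hn : Tendsto (fun N => (n N : ℝ) * ε N ^ 3) atTop (𝓝 (σ ^ 3)))
    {χ : T3 → ℝ} (hχ : Continuous χ) {δ : ℝ} (hδ : 0 < δ) :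
    ∃ K : ℝ, 0 < K ∧ ∀ N : ℕ, μ[ε N, n N, a, u, θ]
        {w | δ < ‖empiricalMomentumField w χ -
          ∫ x, (χ x * rhoLim (profileOf a ha ha0) σ x) • u x‖} ≤
      ENNReal.ofReal (K * Real.exp (-(K⁻¹ * (n N : ℝ)))) := by
  set P := profileOf a ha ha0 with hP
  set ρ₀ := rhoLim P σ with hρ₀
  have hPs : SmallDensity P σ :=
    smallDensity_of_eta_le (Mstar := 2 * P.M) hσ hσ2 (by linarith [P.M_pos]) hsmall
  have hρc : Continuous ρ₀ := hPs.continuous_rhoLim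
  set I : V3 := ∫ x, (χ x * ρ₀ x) • u x with hI
  have hIl : ∀ l : Fin 3, I l = ∫ x, χ x * u x l * ρ₀ x := by
    intro l
    have hint : Integrable (fun x => (χ x * ρ₀ x) • u x) := integrable_of_continuous_T3 ((hχ.mul hρc).smul hu)
    rw [hI, show (∫ x, (χ x * ρ₀ x) • u x) l = (EuclideanSpace.proj l : V3 →L[ℝ] ℝ) (∫ x, (χ x * ρ₀ x) • u x) from rfl,
      ← ContinuousLinearMap.integral_comp_comm _ hint]
    refine integral_congr_ae (Eventually.of_forall fun x => ?_)
    simp only [EuclideanSpace.coe_proj, PiLp.smul_apply, smul_eq_mul]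
    ring
  have hcoord : ∀ l : Fin 3, ∃ K : ℝ, 0 < K ∧ ∀ N : ℕ, μ[ε N, n N, a, u, θ]
      {w | δ / 3 < |(empiricalMomentumField w χ - I) l|} ≤
        ENNReal.ofReal (K * Real.exp (-(K⁻¹ * (n N : ℝ)))) := by
    intro l
    obtain ⟨KA, hKA, hA⟩ := gf_localGibbs_velFluct_Kexp (ε := ε) ha hθ hu ha0 hθ0 hn1
      (Y := fun x v => v l - u x l) (by fun_prop)
      (fun x => by
        rw [integral_sub ((memLp_coord_gaussMeasure (u x) (θ x) l 2 (by simp)).integrable one_le_two)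
          (integrable_const _), integral_coord_gaussMeasure _ (hθ0 x), integral_const]
        simp)
      (expMoment_coord hθ hu l) hχ (δ := δ / 6) (by positivity)
    obtain ⟨KB, hKB, hB⟩ := gf_localGibbs_density_le (u := u) ha hθ hu ha0 hθ0 hσ hσ2 hsmall hε0 hε hn1 hn
      (g := fun y => χ y * u y l) (hχ.mul (by fun_prop)) (δ := δ / 6) (by positivity)
    refine ⟨KA + KB, by positivity, fun N => ?_⟩
    have hn0 : (0 : ℝ) ≤ (n N : ℝ) := Nat.cast_nonneg _
    calc μ[ε N, n N, a, u, θ] {w | δ / 3 < |(empiricalMomentumField w χ - I) l|}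
        = μ[ε N, n N, a, u, θ] {w | 2 * (δ / 6) <
            |((n N : ℕ) : ℝ)⁻¹ * ∑ i, χ (w i).1 * ((w i).2 l - u (w i).1 l) +
              (((n N : ℕ) : ℝ)⁻¹ * ∑ i, χ (w i).1 * u (w i).1 l - ∫ y, χ y * u y l * ρ₀ y)|} := by
          congr 1
          ext w
          simp only [Set.mem_setOf_eq]
          rw [PiLp.sub_apply, empiricalMomentumField_apply_sub w χ u l (I l), hIl,
            show (2 : ℝ) * (δ / 6) = δ / 3 by ring]
      _ ≤ _ := measure_lt_abs_add_le _ _ _ _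
      _ ≤ ENNReal.ofReal (KA * Real.exp (-(KA⁻¹ * (n N : ℝ)))) +
            ENNReal.ofReal (KB * Real.exp (-(KB⁻¹ * (n N : ℝ)))) := add_le_add (hA N) (hB N)
      _ ≤ _ := ofReal_Kexp_add_le hKA hKB hn0
  choose Kl hKl0 hKl using hcoord
  set Kt := ∑ l, Kl l with hKt
  have hKt0 : 0 < Kt := sum_pos (fun l _ => hKl0 l) univ_nonempty
  have hKle : ∀ l, Kl l ≤ Kt := fun l => single_le_sum (fun l _ => (hKl0 l).le) (mem_univ l)
  refine ⟨3 * Kt, by positivity, fun N => ?_⟩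
  have hn0 : (0 : ℝ) ≤ (n N : ℝ) := Nat.cast_nonneg _
  calc μ[ε N, n N, a, u, θ] {w | δ < ‖empiricalMomentumField w χ - I‖}
      ≤ ∑ l, μ[ε N, n N, a, u, θ] {w | δ / 3 < |(empiricalMomentumField w χ - I) l|} :=
        measure_setOf_lt_norm_le _ (fun w => empiricalMomentumField w χ - I) hδ.le
    _ ≤ ∑ _l : Fin 3, ENNReal.ofReal (Kt * Real.exp (-(Kt⁻¹ * (n N : ℝ)))) :=
        sum_le_sum fun l _ => (hKl l N).trans (ENNReal.ofReal_le_ofReal (Kexp_le_Kexp (hKl0 l) (hKle l) hn0))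
    _ = ENNReal.ofReal (3 * (Kt * Real.exp (-(Kt⁻¹ * (n N : ℝ))))) := by
        rw [sum_const, card_univ, Fintype.card_fin, nsmul_eq_mul, Nat.cast_ofNat,
          ENNReal.ofReal_mul (by norm_num : (0 : ℝ) ≤ 3), ENNReal.ofReal_ofNat]
    _ ≤ ENNReal.ofReal ((3 * Kt) * Real.exp (-((3 * Kt)⁻¹ * (n N : ℝ)))) := by
        refine ENNReal.ofReal_le_ofReal ?_
        have h1 := exp_negInv_le hKt0 (by linarith : Kt ≤ 3 * Kt) hn0
        have h2 : 0 < Real.exp (-(Kt⁻¹ * (n N : ℝ))) := Real.exp_pos _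
        nlinarith

/-- **Energy field along a general family.** Under the uniform smallness, for continuous `χ` and `δ > 0`:
`μ_N {δ < |n_N⁻¹ ∑ χ(xᵢ)|vᵢ|²/2 - ∫ χ E(ρ₀,u,θ)|} ≤ K e^{-n_N/K}` for all `N` (kinetic-energy fluctuation + density
field with weight `χ(|u|²/2 + 3θ/2)`). [folklore] -/
theorem gf_localGibbs_energy_le (ha : Continuous a) (hθ : Continuous θ) (hu : Continuous u)
    (ha0 : ∀ x, 0 < a x) (hθ0 : ∀ x, 0 < θ x) (hσ : 0 < σ) (hσ2 : σ < 1 / 2)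
    (hsmall : Real.exp 1 * (2 * (profileOf a ha ha0).M * v₁ * σ ^ 3) ≤ 1 / 32)
    (hε0 : ∀ N, 0 < ε N) (hε : Tendsto ε atTop (𝓝 0)) (hn1 : ∀ N, 1 ≤ n N)
    (hn : Tendsto (fun N => (n N : ℝ) * ε N ^ 3) atTop (𝓝 (σ ^ 3)))
    {χ : T3 → ℝ} (hχ : Continuous χ) {δ : ℝ} (hδ : 0 < δ) :
    ∃ K : ℝ, 0 < K ∧ ∀ N : ℕ, μ[ε N, n N, a, u, θ]
        {w | δ < |empiricalEnergyField w χ -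
          ∫ x, χ x * totalEnergyDensity (rhoLim (profileOf a ha ha0) σ x) (u x) (θ x)|} ≤
      ENNReal.ofReal (K * Real.exp (-(K⁻¹ * (n N : ℝ)))) := by
  set P := profileOf a ha ha0 with hP
  set ρ₀ := rhoLim P σ with hρ₀
  have hI : ∫ x, χ x * totalEnergyDensity (ρ₀ x) (u x) (θ x) =
      ∫ x, χ x * (‖u x‖ ^ 2 / 2 + Fintype.card (Fin 3) * θ x / 2) * ρ₀ x := by
    refine integral_congr_ae (Eventually.of_forall fun x => ?_)
    simp only [totalEnergyDensity, Fintype.card_fin, Nat.cast_ofNat]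
    ring
  obtain ⟨KA, hKA, hA⟩ := gf_localGibbs_velFluct_Kexp (ε := ε) ha hθ hu ha0 hθ0 hn1
    (Y := fun x v => ‖v‖ ^ 2 / 2 - ‖u x‖ ^ 2 / 2 - Fintype.card (Fin 3) * θ x / 2) (by fun_prop)
    (fun x => integral_energy_gaussMeasure (u x) (hθ0 x)) (expMoment_energy hθ hu hθ0) hχ
    (δ := δ / 2) (by positivity)
  obtain ⟨KB, hKB, hB⟩ := gf_localGibbs_density_le (u := u) ha hθ hu ha0 hθ0 hσ hσ2 hsmall hε0 hε hn1 hn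
    (g := fun y => χ y * (‖u y‖ ^ 2 / 2 + Fintype.card (Fin 3) * θ y / 2)) (by fun_prop)
    (δ := δ / 2) (by positivity)
  refine ⟨KA + KB, by positivity, fun N => ?_⟩
  have hn0 : (0 : ℝ) ≤ (n N : ℝ) := Nat.cast_nonneg _
  calc μ[ε N, n N, a, u, θ] {w | δ < |empiricalEnergyField w χ -
          ∫ x, χ x * totalEnergyDensity (ρ₀ x) (u x) (θ x)|}
      = μ[ε N, n N, a, u, θ] {w | 2 * (δ / 2) <
          |((n N : ℕ) : ℝ)⁻¹ * ∑ i, χ (w i).1 * (‖(w i).2‖ ^ 2 / 2 - ‖u (w i).1‖ ^ 2 / 2 -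
              Fintype.card (Fin 3) * θ (w i).1 / 2) +
            (((n N : ℕ) : ℝ)⁻¹ * ∑ i, χ (w i).1 * (‖u (w i).1‖ ^ 2 / 2 +
              Fintype.card (Fin 3) * θ (w i).1 / 2) -
              ∫ y, χ y * (‖u y‖ ^ 2 / 2 + Fintype.card (Fin 3) * θ y / 2) * ρ₀ y)|} := by
        congr 1
        ext w
        simp only [Set.mem_setOf_eq]
        rw [empiricalEnergyField_sub w χ u θ _, hI, show (2 : ℝ) * (δ / 2) = δ by ring]
    _ ≤ _ := measure_lt_abs_add_le _ _ _ _
    _ ≤ ENNReal.ofReal (KA * Real.exp (-(KA⁻¹ * (n N : ℝ)))) +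
          ENNReal.ofReal (KB * Real.exp (-(KB⁻¹ * (n N : ℝ)))) := add_le_add (hA N) (hB N)
    _ ≤ _ := ofReal_Kexp_add_le hKA hKB hn0

end Fields

/-! ### The stub -/

section General

variable {a θ : T3 → ℝ} {u : T3 → V3}

/-- The Liouville restriction is invisible for the canonical density (it vanishes off the hard-sphere domain):
`(liouville 𝕋³ m ε).withDensity (ofReal ∘ W) = volume.withDensity (ofReal ∘ W)` for `W = canonicalDensity …`.
[folklore] -/
theorem gf_withDensity_liouville_eq (e : ℝ) (m : ℕ) (f : T3 × V3 → ℝ) :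
    (Literature.Analysis.FluidPDE.liouville (Torus.geometry (Fin 3)) m e).withDensity
        (fun z => ENNReal.ofReal (canonicalDensity (Torus.geometry (Fin 3)) e m f z)) =
      volume.withDensity fun z => ENNReal.ofReal (canonicalDensity (Torus.geometry (Fin 3)) e m f z) := by
  ext A hA
  have hsupp : Function.support (fun z => ENNReal.ofReal (canonicalDensity (Torus.geometry (Fin 3)) e m f z)) ⊆
      hardSphereDomain (Torus.geometry (Fin 3)) m e := by
    intro z hz
    by_contra hzD
    exact hz (by simp [canonicalDensity_eq_zero_of_notMem _ _ _ _ hzD])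
  rw [withDensity_apply _ hA, withDensity_apply _ hA, liouville_eq, Measure.restrict_restrict hA, Set.inter_comm,
    ← Measure.restrict_restrict' hA]
  exact setLIntegral_eq_of_support_subset hsupp

/-- **The flow-free local Gibbs measure at any scale is a sub-probability**: `μ(A) ≤ 1`. [folklore] -/
theorem gf_localGibbs_le_one (ha : Continuous a) (hθ : Continuous θ) (hu : Continuous u) (ha0 : ∀ x, 0 ≤ a x)
    (hθ0 : ∀ x, 0 < θ x) (e : ℝ) (m : ℕ) (A : Set (Config m (Fin 3) T3)) :
    (volume.withDensity fun z =>
        ENNReal.ofReal (canonicalDensity (Torus.geometry (Fin 3)) e m (localGibbsProfile a u θ) z)) A ≤ 1 := by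
  refine (measure_mono (Set.subset_univ A)).trans ?_
  have h := gf_lintegral_localGibbs ha hθ hu ha0 hθ0 e m (G := fun _ => 1) measurable_const
  simp only [lintegral_const, measure_univ, mul_one, one_mul] at h
  rw [h]
  exact gf_lintegral_posDensity_le_one ha ha0 e m

end General


/-- Transfer of an event bound along an equality of particle numbers (the reference laws of the crux are indexed by
the TERM `n N`; the general-family bounds are proved for `max (n N) 1`), together with the invisibility of the
Liouville restriction. [folklore] -/
theorem gf_transfer {m m' : ℕ} (h : m = m') (Φ : (k : ℕ) → Set (Config k (Fin 3) T3)) (e : ℝ) (f : T3 × V3 → ℝ) :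
    (Literature.Analysis.FluidPDE.liouville (Torus.geometry (Fin 3)) m e).withDensity
        (fun z => ENNReal.ofReal (canonicalDensity (Torus.geometry (Fin 3)) e m f z)) (Φ m) =
      (volume.withDensity fun z => ENNReal.ofReal (canonicalDensity (Torus.geometry (Fin 3)) e m' f z)) (Φ m') := by
  subst h
  rw [gf_withDensity_liouville_eq]

/-- **S2 — EXPONENTIAL CONCENTRATION OF THE THREE FIELDS UNDER MATCHED LOCAL GIBBS LAWS, GENERAL FAMILIES**
(registered stub `stub_concentrationGeneralFamilies` of the line `means-pin-entropy`, crux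
`RelayRaceLocality.NearConstantShortTimeHL`, stmt-AtomisticToContinuum-12502). Witness `η₁ = thresh r η₂` for the
insertion-factor package `(r, η₂)` of `insertionFactor_package`. For `σ > 0`, a continuous unit-mass density
`c ≤ ρ₁`, `ρ₁σ³ ≤ η₁`, continuous `u₁`, `θ₁ > 0` and an admissible family (`ε_N > 0`, `ε_N → 0`, `n_N ε_N³ → σ³`),
the canonical laws of `n_N` spheres of diameter `ε_N` with profile `localGibbsProfile (ρ₁e^{g_σ(ρ₁)}) u₁ θ₁` have
empirical density / momentum / energy fields within `δ` of `∫χρ₁`, `∫(χρ₁)•u₁`, `∫χE(ρ₁,u₁,θ₁)` except on a set of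
mass `≤ C e^{-n_N/C}`, for every continuous `χ`, `δ > 0` and ALL `N`. -/
theorem stub_concentrationGeneralFamilies : GeneralFamilyConcentration := by
  obtain ⟨r, hr, Rf, hsol, hbd, hcont, huniq, η₂, hη₂, -, hexp⟩ := insertionFactor_package
  refine ⟨thresh r η₂, thresh_pos hr hη₂, ?_⟩
  intro σ hσ
  dsimp only
  intro c hc ρ₁ hρ₁c hband hρ₁1 u₁ θ₁ hu hθ hθ0 ε n hε0 hε hn χ hχ δ hδ
  have hρ0 : ∀ x, 0 < ρ₁ x := fun x => hc.trans_le (hband x).1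
  have hpack : ∀ x, ρ₁ x * σ ^ 3 ≤ thresh r η₂ := fun x => (hband x).2
  obtain ⟨hσ2, -, ha, ha0, -, -, hlim, hsmall⟩ :=
    thermoActivity_spec hr hsol hbd hcont huniq hη₂ hexp hσ hρ₁c hρ0 hρ₁1 hpack
  -- the family with particle numbers `max (n N) 1`
  set n' : ℕ → ℕ := fun N => max (n N) 1 with hn'def
  have hn1' : ∀ N, 1 ≤ n' N := fun N => le_max_right _ _
  have hnat := gf_tendsto_atTop hσ hε0 hε hn
  have hn'eq : ∀ᶠ N in atTop, n' N = n N := (hnat.eventually_ge_atTop 1).mono fun N h => max_eq_left h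
  have hn' : Tendsto (fun N => (n' N : ℝ) * ε N ^ 3) atTop (𝓝 (σ ^ 3)) :=
    hn.congr' (hn'eq.mono fun N h => by simp only [h])
  obtain ⟨K₁, hK₁, h₁⟩ := gf_localGibbs_density_le (u := u₁) ha hθ hu ha0 hθ0 hσ hσ2 hsmall hε0 hε hn1' hn' hχ hδ
  obtain ⟨K₂, hK₂, h₂⟩ := gf_localGibbs_momentum_le ha hθ hu ha0 hθ0 hσ hσ2 hsmall hε0 hε hn1' hn' hχ hδ
  obtain ⟨K₃, hK₃, h₃⟩ := gf_localGibbs_energy_le ha hθ hu ha0 hθ0 hσ hσ2 hsmall hε0 hε hn1' hn' hχ hδ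
  rw [hlim] at h₁ h₂ h₃
  set C := K₁ + K₂ + K₃ + 1 with hCdef
  refine ⟨C, by positivity, fun N => ?_⟩
  have hK1C : K₁ ≤ C := by rw [hCdef]; linarith
  have hK2C : K₂ ≤ C := by rw [hCdef]; linarith
  have hK3C : K₃ ≤ C := by rw [hCdef]; linarith
  have hC0 : 0 < C := by positivity
  rcases Nat.eq_zero_or_pos (n N) with h0 | hpos
  · -- no particles: the law is a sub-probability and `C e⁰ = C ≥ 1`
    have hC1 : (1 : ℝ≥0∞) ≤ ENNReal.ofReal (C * Real.exp (-(C⁻¹ * (n N : ℝ)))) := by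
      have hz : (n N : ℝ) = 0 := by exact_mod_cast h0
      rw [hz, mul_zero, neg_zero, Real.exp_zero, mul_one, ← ENNReal.ofReal_one]
      exact ENNReal.ofReal_le_ofReal (by rw [hCdef]; linarith)
    simp only [gf_withDensity_liouville_eq]
    exact ⟨(gf_localGibbs_le_one ha hθ hu (fun x => (ha0 x).le) hθ0 _ _ _).trans hC1,
      (gf_localGibbs_le_one ha hθ hu (fun x => (ha0 x).le) hθ0 _ _ _).trans hC1,
      (gf_localGibbs_le_one ha hθ hu (fun x => (ha0 x).le) hθ0 _ _ _).trans hC1⟩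
  · have hn'N : n N = n' N := (max_eq_left (Nat.one_le_of_lt hpos)).symm
    have hcast : ((n' N : ℕ) : ℝ) = (n N : ℝ) := by rw [hn'N]
    have hn0 : (0 : ℝ) ≤ (n N : ℝ) := Nat.cast_nonneg _
    have hrate : ∀ {K : ℝ}, 0 < K → K ≤ C →
        ENNReal.ofReal (K * Real.exp (-(K⁻¹ * (n' N : ℝ)))) ≤ ENNReal.ofReal (C * Real.exp (-(C⁻¹ * (n N : ℝ)))) :=
      fun hK hKC => ENNReal.ofReal_le_ofReal (by rw [hcast]; exact Kexp_le_Kexp hK hKC hn0)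
    refine ⟨?_, ?_, ?_⟩
    · simp only [empiricalDensityField_eq_sum]
      exact (gf_transfer hn'N (fun k => {z : Config k (Fin 3) T3 |
          δ < |(k : ℝ)⁻¹ * ∑ i, χ (z i).1 - ∫ x, χ x * ρ₁ x|}) (ε N) _).le.trans ((h₁ N).trans (hrate hK₁ hK1C))
    · exact (gf_transfer hn'N (fun k => {z : Config k (Fin 3) T3 |
          δ < ‖empiricalMomentumField z χ - ∫ x, (χ x * ρ₁ x) • u₁ x‖}) (ε N) _).le.trans
        ((h₂ N).trans (hrate hK₂ hK2C))
    · exact (gf_transfer hn'N (fun k => {z : Config k (Fin 3) T3 |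
          δ < |empiricalEnergyField z χ - ∫ x, χ x * totalEnergyDensity (ρ₁ x) (u₁ x) (θ₁ x)|}) (ε N) _).le.trans
        ((h₃ N).trans (hrate hK₃ hK3C))

end Summit.AtomisticToContinuum.HydrodynamicLimit.Theorems.NearConstantShortTimeHL

end
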